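import Literature.NumberTheory.LFunctions.Zhang2022.Section10Lemma102Windows
import Literature.NumberTheory.LFunctions.Zhang2022.SkeletonLemma102RelW
import Literature.NumberTheory.LFunctions.Zhang2022.RepairGapLemma102LogMeanPremise
import HarnessLib

/-!
# Zhang (2022), rescue GAP/BED (D-0124 (3)(4)): Lemma 10.2 — the window bound (10.11) (`Typed.Sec10Rel.Eq1011RelD`)
# under the minimum premise `‖L(1,χ)‖ ≤ 𝓛⁻¹⁵`, UNCONDITIONAL

Topic `Literature/NumberTheory/LFunctions/Zhang2022` (Landau–Siegel audit tree; verdict-neutral).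
Y. Zhang, *Discrete mean estimates and the Landau–Siegel zero*, arXiv:2211.02515v1 (2022)
[Zhang2022LandauSiegel] — **an unrefereed manuscript under adjudication; nothing in this file asserts or
denies its Theorems 1–2, and nothing here is a claim about Landau–Siegel zeros. The programme SEARCHES and
TYPES; no claim about Landau–Siegel zeros, Theorems 1–2 of arXiv:2211.02515 or a repaired Margin232 until a
kernel theorem says so.**

The tree's `Section10Lemma102Windows` derives the window clause (10.11) of Lemma 10.2 (reading of record RT-01′, tail-mean
form `‖𝔳₂ⱼ(d,r)‖ ≤ C·𝓛(1 + log T)⁴/log P·(∏_{q∣dr}(1−q⁻¹)⁻¹)²` on the three edge windows) from LEMMA A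
(`Lemma102.logMeanRel_of_lemma83Rel`) and the guard-free tail mean `XiZeroMajorant.xiZeroTailMean`; Assumption (A) enters
ONLY through LEMMA A. With LEMMA A kernel under `‖L(1,χ)‖ ≤ 𝓛⁻¹⁵` (`Lemma102.logMean0Rel_pow15`, file
`RepairGapLemma102LogMeanPremise`), the same proofs VERBATIM (guard text swapped) give, UNCONDITIONALLY:
`frakv2_low_le_pow15` (`dr < P^{0.504}`, `C = 2000·K₁`), `frakv2_windows_le_pow15` (the three windows), and the typed
window clause `eq1011RelD_pow15` = body of `Typed.Sec10Rel.Eq1011RelD c′` with guard `↦ ‖L(1,χ)‖ ≤ 𝓛⁻¹⁵` (twin of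
`Lemma102.eq1011RelD_of_lemma83Rel`), plus `eq1011RelD_of_assumptionAWith` (every real `E ≥ 15`). Clause 4 of the
`𝓛⁻¹⁵` Lemma 10.2 assembled in `RepairGapLemma102LeafUnconditional`; rescue GAP row G-31. Theorems only; no definition,
no named fact; nothing about (A) itself.

## References

* Y. Zhang, arXiv:2211.02515v1 (2022), §10 Lemma 10.2 (10.11), pp. 55–56. [cite: Zhang2022LandauSiegel, §10 Lemma 10.2]
-/

noncomputable section

open Complex Real Finset

namespace Literature.NumberTheory.LFunctions.Zhang2022.Lemma102

open Skeleton
open Literature.NumberTheory.LFunctions.Zhang2022.Repair.Bed (AssumptionAWith)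

/-- A threshold `D₁` beyond which `log D ≥ M`. [folklore] -/
private theorem exists_nat_le_log₄ (M : ℝ) : ∃ D₀ : ℕ, ∀ D : ℕ, D₀ ≤ D → M ≤ Real.log D := by
  refine ⟨⌈Real.exp M⌉₊ + 1, fun D hD => ?_⟩
  have h1 : Real.exp M ≤ D := by
    have : (⌈Real.exp M⌉₊ : ℝ) + 1 ≤ D := by exact_mod_cast hD
    linarith [Nat.le_ceil (Real.exp M)]
  have hD0 : (0 : ℝ) < D := lt_of_lt_of_le (Real.exp_pos M) h1
  rw [Real.le_log_iff_exp_le hD0]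
  exact h1

set_option maxHeartbeats 800000 in
/-- **The derivable form of (10.11) on `1 ≤ dr < P^{0.504}` UNDER THE MINIMUM PREMISE, UNCONDITIONAL** (twin of `Lemma102.frakv2_low_le_of_lemma83Rel`, proof verbatim, LEMMA A taken from `logMean0Rel_pow15`; guard `↦ ‖L(1,χ)‖ ≤ 𝓛⁻¹⁵`) — **the derivable form of (10.11)** (a superset of the three edge windows):
under `Skeleton.Lemma83Rel c′` there is `C` with, for `D` large, (A), `1 ≤ j ≤ 3`, `d, r ≥ 1`,
`dr < P^{0.504}`: `‖𝔳₂ⱼ(d,r)‖ ≤ C·𝓛(1 + 𝓛^{1.1})⁴(𝓛⁹)⁻¹·(∏_{q∣dr}(1−q⁻¹)⁻¹)²`. Each of the three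
log-means of the tent decomposition is `0` (`X < 1`), `≪ 𝓛(1+log T)⁴` (`1 ≤ X ≤ T`, tail mean of
`ξ₀ⱼ`) or `≪ 𝓛²R` (`T ≤ X ≤ P`, LEMMA A). [cite: Zhang2022LandauSiegel, §10 Lemma 10.2 (10.11)] -/
theorem frakv2_low_le_pow15 (c' : ℝ) :
    ∃ C : ℝ, ForAllLarge fun D _ χ => ‖χ.LFunction 1‖ ≤ 1 / Real.log D ^ 15 → ∀ j ∈ ({1, 2, 3} : Finset ℕ), ∀ d r : ℕ,
      1 ≤ d → 1 ≤ r → ((d * r : ℕ) : ℝ) < bigP D ^ (0.504 : ℝ) →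
        ‖frakv2 c' χ j d r‖ ≤
          C * (ell D * (1 + ell D ^ (1.1 : ℝ)) ^ 4 * (ell D ^ 9)⁻¹) *
            (∏ q ∈ (d * r).primeFactors, (1 - (q : ℝ)⁻¹)⁻¹) ^ 2 := by
  obtain ⟨CA, DA, hA⟩ := logMean0Rel_pow15 c'
  obtain ⟨Cξ, Dξ, hξ⟩ := XiZeroMajorant.xiZeroTailMean c'
  obtain ⟨D₅, hD₅⟩ := exists_nat_le_log₄ 5
  -- constants
  set b₀ : ℝ := 3 * π * (1 + 5 * |c'| * π) with hb₀
  have hb₀0 : 0 ≤ b₀ := by positivity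
  set cb : ℝ := 1 + 2 * b₀ + b₀ ^ 2 / 2 with hcb
  have hcb1 : 1 ≤ cb := by rw [hcb]; nlinarith
  set K₁ : ℝ := 4 * Real.exp (9 / 2) * cb + |CA| + |Cξ| with hK₁
  have hK₁0 : 0 ≤ K₁ := by positivity
  refine ⟨2000 * K₁, max (max DA Dξ) D₅, fun D _ χ hD hq hp hAA j hj d r hd hr hdr => ?_⟩
  have hDA : DA ≤ D := le_trans (le_trans (le_max_left _ _) (le_max_left _ _)) hD
  have hDξ : Dξ ≤ D := le_trans (le_trans (le_max_right _ _) (le_max_left _ _)) hD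
  have hL5 : 5 ≤ ell D := by rw [ell]; exact hD₅ D (le_trans (le_max_right _ _) hD)
  set 𝓛 : ℝ := ell D with h𝓛def
  have h𝓛3 : 3 ≤ Real.log D := by rw [← ell, ← h𝓛def]; linarith
  have h𝓛1 : 1 ≤ 𝓛 := by linarith
  have h𝓛0 : 0 < 𝓛 := by linarith
  have hD3 : 3 ≤ D := by
    by_contra h
    have hD2 : D ≤ 2 := by omega
    have : Real.log (D : ℝ) ≤ Real.log 2 := by
      rcases Nat.eq_zero_or_pos D with h0 | h0
      · rw [h0]; simp; exact Real.log_nonneg one_le_two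
      · exact Real.log_le_log (by exact_mod_cast h0) (by exact_mod_cast hD2)
    have h2 : Real.log 2 < 1 := by
      have := Real.log_two_lt_d9; linarith
    linarith
  -- parameters
  have hP1 : 1 < bigP D := by rw [bigP]; exact Real.one_lt_exp_iff.2 (by positivity)
  have hP0 : 0 < bigP D := by linarith
  have hlogP : Real.log (bigP D) = 𝓛 ^ 9 := by rw [bigP, Real.log_exp]
  obtain ⟨hτ2, hTP⟩ := bigT_lt_rpow (D := D) hL5
  have hT1 : 1 ≤ bigT D := by
    rw [bigT]; exact Real.one_le_exp (Real.rpow_nonneg (by linarith) _)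
  have hT0 : 0 < bigT D := by linarith
  have hlogT : Real.log (bigT D) = 𝓛 ^ (1.1 : ℝ) := by rw [bigT, Real.log_exp]
  have hlogT0 : 0 ≤ Real.log (bigT D) := Real.log_nonneg hT1
  -- `y = dr`
  have hy1 : (1 : ℝ) ≤ ((d * r : ℕ) : ℝ) := by
    have : 1 ≤ d * r := Nat.one_le_iff_ne_zero.mpr (Nat.mul_ne_zero (by omega) (by omega))
    exact_mod_cast this
  have hy0 : (0 : ℝ) < ((d * r : ℕ) : ℝ) := by linarith
  have hdrP1 : ((d * r : ℕ) : ℝ) < Skeleton.P1 D := hdr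
  have hdrPT : ((d * r : ℕ) : ℝ) < bigP D / bigT D ^ 2 :=
    lt_trans hdrP1 (P1_lt_P_div_T_sq (D := D) (by linarith))
  -- the relative factor
  set R : ℝ := (∏ q ∈ (d * r).primeFactors, (1 - (q : ℝ)⁻¹)⁻¹) ^ 2 with hRdef
  have hR1 : 1 ≤ R := by
    rw [hRdef]
    exact one_le_pow₀
      (Literature.NumberTheory.Sieve.GreenTao2008.GYCorr.one_le_prod_one_sub_inv_inv (d * r))
  have hR0 : 0 ≤ R := by linarith
  -- `|L′(1,χ)| ≤ 4e^{9/2}𝓛²`, `|Π| ≤ R`, `‖β_i‖𝓛⁹ ≤ b₀`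
  have hℓ : ‖deriv χ.LFunction 1‖ ≤ 4 * Real.exp (9 / 2) * 𝓛 ^ 2 := by
    have h := Lemma31.norm_deriv_LFunction_le_near_one χ h𝓛3 hp (w := 1)
      (by rw [sub_self, norm_zero]; positivity)
    rw [← ell, ← h𝓛def] at h
    refine h.trans ?_
    have h2 : (1 + 𝓛) * 𝓛 ≤ 2 * 𝓛 ^ 2 := by nlinarith
    have he := Real.exp_pos (9 / 2)
    calc 2 * Real.exp (9 / 2) * (1 + 𝓛) * 𝓛 = 2 * Real.exp (9 / 2) * ((1 + 𝓛) * 𝓛) := by ring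
      _ ≤ 2 * Real.exp (9 / 2) * (2 * 𝓛 ^ 2) := by gcongr
      _ = 4 * Real.exp (9 / 2) * 𝓛 ^ 2 := by ring
  have hPi : ‖PiW χ d r‖ ≤ R := Lemma84.norm_PiW_le_prodInv χ (by omega) (by omega)
  have hβ9 : ∀ i : ℕ, ‖betaJ c' D i‖ * 𝓛 ^ 9 ≤ b₀ := fun i =>
    Typed.Sec10A.norm_betaJ_mul_ell9_le c' hD3 i
  -- the uniform bound `B` for one log-mean with `X ≤ P^{0.504}/dr`
  set B : ℝ := (‖deriv χ.LFunction 1‖ * cb + |CA| * (𝓛 ^ 6)⁻¹) * R +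
    |Cξ| * 𝓛 * (1 + 𝓛 ^ (1.1 : ℝ)) ^ 4 with hBdef
  have hBmain0 : 0 ≤ (‖deriv χ.LFunction 1‖ * cb + |CA| * (𝓛 ^ 6)⁻¹) * R := by positivity
  have hBtail0 : 0 ≤ |Cξ| * 𝓛 * (1 + 𝓛 ^ (1.1 : ℝ)) ^ 4 := by positivity
  have hB0 : 0 ≤ B := by rw [hBdef]; positivity
  have hpiece : ∀ a : ℝ, a ≤ 0.504 →
      ‖∑ n ∈ Finset.Ioc 0 ⌊bigP D ^ a / ((d * r : ℕ) : ℝ)⌋₊,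
          χ (n : ZMod D) * xiZero c' D j n d r / (n : ℂ) *
            (Real.log (bigP D ^ a / ((d * r : ℕ) : ℝ) / n) : ℂ)‖ ≤ B := by
    intro a ha
    set X : ℝ := bigP D ^ a / ((d * r : ℕ) : ℝ) with hXdef
    have hXP : X ≤ bigP D := by
      calc X ≤ bigP D ^ a := div_le_self (by positivity) hy1
        _ ≤ bigP D ^ (1 : ℝ) := Real.rpow_le_rpow_of_exponent_le hP1.le (by linarith)
        _ = bigP D := Real.rpow_one _
    rcases lt_or_ge X 1 with hX1 | hX1
    · -- `X < 1`: the log-mean vanishes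
      rw [logMean_eq_zero_of_lt_one (fun n => χ (n : ZMod D) * xiZero c' D j n d r / (n : ℂ)) hX1,
        norm_zero]
      exact hB0
    have hX0 : 0 < X := by linarith
    have hlogX0 : 0 ≤ Real.log X := Real.log_nonneg hX1
    rcases le_or_gt X (bigT D) with hXT | hXT
    · -- `1 ≤ X ≤ T`: the tail mean
      have htail := hξ D χ hDξ hq hp j hj d r hd hr hdrP1 X hX1 hXT
      have hlogXT : Real.log X ≤ 𝓛 ^ (1.1 : ℝ) := by
        rw [← hlogT]; exact Real.log_le_log hX0 hXT
      have hsum0 : 0 ≤ ∑ n ∈ Finset.Ico 1 ⌈X⌉₊, ‖xiZero c' D j n d r‖ / n :=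
        Finset.sum_nonneg fun n _ => by positivity
      calc _ ≤ Real.log X * ∑ n ∈ Finset.Ico 1 ⌈X⌉₊, ‖xiZero c' D j n d r‖ / n :=
            norm_logMean_le_log_mul_tail c' χ j d r hX1
        _ ≤ Real.log X * (Cξ * ell D * (1 + Real.log X) ^ 3) :=
            mul_le_mul_of_nonneg_left htail hlogX0
        _ ≤ Real.log X * (|Cξ| * ell D * (1 + Real.log X) ^ 3) := by
            gcongr; exact le_abs_self _
        _ ≤ (1 + 𝓛 ^ (1.1 : ℝ)) * (|Cξ| * 𝓛 * (1 + 𝓛 ^ (1.1 : ℝ)) ^ 3) := by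
            rw [← h𝓛def]
            apply mul_le_mul (by linarith) _ (by positivity) (by positivity)
            gcongr
        _ = |Cξ| * 𝓛 * (1 + 𝓛 ^ (1.1 : ℝ)) ^ 4 := by ring
        _ ≤ B := by rw [hBdef]; linarith [hBmain0]
    · -- `T < X ≤ P`: LEMMA A
      have hAX := hA D χ hDA hq hp hAA j hj d r hd hr hdrPT X hXT.le hXP
      have hlogXP : Real.log X ≤ 𝓛 ^ 9 := by
        rw [← hlogP]; exact Real.log_le_log hX0 hXP
      have hβL : ∀ i : ℕ, ‖betaJ c' D i‖ * Real.log X ≤ b₀ := fun i =>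
        le_trans (mul_le_mul_of_nonneg_left hlogXP (norm_nonneg _)) (hβ9 i)
      have hmain := norm_logMean_main_le c' χ j d r hlogX0 hb₀0 (hβL (j + 1)) (hβL (j + 2))
      calc _ ≤ ‖(∑ n ∈ Finset.Ioc 0 ⌊X⌋₊, χ (n : ZMod D) * xiZero c' D j n d r / (n : ℂ) *
                (Real.log (X / n) : ℂ)) -
              deriv χ.LFunction 1 * PiW χ d r *
                (1 + (betaJ c' D (j + 1) + betaJ c' D (j + 2)) * (Real.log X : ℂ) +
                  betaJ c' D (j + 1) * betaJ c' D (j + 2) * (Real.log X : ℂ) ^ 2 / 2)‖ +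
            ‖deriv χ.LFunction 1 * PiW χ d r *
                (1 + (betaJ c' D (j + 1) + betaJ c' D (j + 2)) * (Real.log X : ℂ) +
                  betaJ c' D (j + 1) * betaJ c' D (j + 2) * (Real.log X : ℂ) ^ 2 / 2)‖ :=
            norm_le_norm_sub_add _ _
        _ ≤ CA * (ell D ^ 6)⁻¹ * R + ‖deriv χ.LFunction 1‖ * ‖PiW χ d r‖ * cb :=
            add_le_add hAX hmain
        _ ≤ |CA| * (𝓛 ^ 6)⁻¹ * R + ‖deriv χ.LFunction 1‖ * R * cb := by
            rw [← h𝓛def]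
            gcongr
            exact le_abs_self _
        _ = (‖deriv χ.LFunction 1‖ * cb + |CA| * (𝓛 ^ 6)⁻¹) * R := by ring
        _ ≤ B := by rw [hBdef]; linarith [hBtail0]
  -- the tent decomposition and the sum of the three pieces
  have hdec := frakv2_eq_logMeans (χ := χ) c' j hd hr hP1
  have h1 := hpiece 0.504 le_rfl
  have h2 := hpiece 0.502 (by norm_num)
  have h3 := hpiece 0.5 (by norm_num)
  have hcoef : ‖(((500 / Real.log (bigP D) : ℝ)) : ℂ)‖ = 500 / 𝓛 ^ 9 := by
    rw [Complex.norm_real, hlogP, Real.norm_of_nonneg (by positivity)]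
  have hv : ‖frakv2 c' χ j d r‖ ≤ 500 / 𝓛 ^ 9 * (4 * B) := by
    rw [hdec, norm_mul, hcoef]
    refine mul_le_mul_of_nonneg_left ?_ (by positivity)
    calc _ ≤ ‖(∑ n ∈ Finset.Ioc 0 ⌊bigP D ^ (0.504 : ℝ) / ((d * r : ℕ) : ℝ)⌋₊,
              χ (n : ZMod D) * xiZero c' D j n d r / (n : ℂ) *
                (Real.log (bigP D ^ (0.504 : ℝ) / ((d * r : ℕ) : ℝ) / n) : ℂ)) -
            2 * (∑ n ∈ Finset.Ioc 0 ⌊bigP D ^ (0.502 : ℝ) / ((d * r : ℕ) : ℝ)⌋₊,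
              χ (n : ZMod D) * xiZero c' D j n d r / (n : ℂ) *
                (Real.log (bigP D ^ (0.502 : ℝ) / ((d * r : ℕ) : ℝ) / n) : ℂ))‖ +
            ‖∑ n ∈ Finset.Ioc 0 ⌊bigP D ^ (0.5 : ℝ) / ((d * r : ℕ) : ℝ)⌋₊,
              χ (n : ZMod D) * xiZero c' D j n d r / (n : ℂ) *
                (Real.log (bigP D ^ (0.5 : ℝ) / ((d * r : ℕ) : ℝ) / n) : ℂ)‖ := norm_add_le _ _
      _ ≤ (B + 2 * B) + B := by
          gcongr
          · calc _ ≤ ‖∑ n ∈ Finset.Ioc 0 ⌊bigP D ^ (0.504 : ℝ) / ((d * r : ℕ) : ℝ)⌋₊,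
                    χ (n : ZMod D) * xiZero c' D j n d r / (n : ℂ) *
                      (Real.log (bigP D ^ (0.504 : ℝ) / ((d * r : ℕ) : ℝ) / n) : ℂ)‖ +
                  ‖2 * (∑ n ∈ Finset.Ioc 0 ⌊bigP D ^ (0.502 : ℝ) / ((d * r : ℕ) : ℝ)⌋₊,
                    χ (n : ZMod D) * xiZero c' D j n d r / (n : ℂ) *
                      (Real.log (bigP D ^ (0.502 : ℝ) / ((d * r : ℕ) : ℝ) / n) : ℂ))‖ :=
                  norm_sub_le _ _
              _ ≤ B + 2 * B := by
                  rw [norm_mul, Complex.norm_ofNat]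
                  gcongr
      _ = 4 * B := by ring
  refine hv.trans ?_
  -- bookkeeping: `2000B/𝓛⁹ ≤ 2000K₁·𝓛(1+𝓛^{1.1})⁴(𝓛⁹)⁻¹·R`
  set W : ℝ := 𝓛 * (1 + 𝓛 ^ (1.1 : ℝ)) ^ 4 with hWdef
  have hτ1 : 𝓛 ≤ 𝓛 ^ (1.1 : ℝ) := by
    calc 𝓛 = 𝓛 ^ (1 : ℝ) := (Real.rpow_one _).symm
      _ ≤ 𝓛 ^ (1.1 : ℝ) := Real.rpow_le_rpow_of_exponent_le h𝓛1 (by norm_num)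
  have h1τ : 1 ≤ 1 + 𝓛 ^ (1.1 : ℝ) := by linarith
  have hW1 : 𝓛 ^ 2 ≤ W := by
    rw [hWdef]
    have h4 : 𝓛 ≤ (1 + 𝓛 ^ (1.1 : ℝ)) ^ 4 := by
      calc 𝓛 ≤ 1 + 𝓛 ^ (1.1 : ℝ) := by linarith
        _ ≤ (1 + 𝓛 ^ (1.1 : ℝ)) ^ 4 := le_self_pow₀ h1τ (by norm_num)
    calc 𝓛 ^ 2 = 𝓛 * 𝓛 := by ring
      _ ≤ 𝓛 * (1 + 𝓛 ^ (1.1 : ℝ)) ^ 4 := by gcongr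
  have hW2 : 1 ≤ W := le_trans (by nlinarith) hW1
  have hW0 : 0 ≤ W := by linarith
  have hBle : B ≤ K₁ * W * R := by
    rw [hBdef, hK₁]
    have e1 : ‖deriv χ.LFunction 1‖ * cb * R ≤ 4 * Real.exp (9 / 2) * cb * W * R := by
      have : ‖deriv χ.LFunction 1‖ * cb ≤ 4 * Real.exp (9 / 2) * cb * W := by
        calc ‖deriv χ.LFunction 1‖ * cb ≤ 4 * Real.exp (9 / 2) * 𝓛 ^ 2 * cb := by gcongr
          _ ≤ 4 * Real.exp (9 / 2) * W * cb := by gcongr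
          _ = 4 * Real.exp (9 / 2) * cb * W := by ring
      exact mul_le_mul_of_nonneg_right this hR0
    have e2 : |CA| * (𝓛 ^ 6)⁻¹ * R ≤ |CA| * W * R := by
      have h6 : (𝓛 ^ 6)⁻¹ ≤ 1 := inv_le_one_of_one_le₀ (one_le_pow₀ h𝓛1)
      have : |CA| * (𝓛 ^ 6)⁻¹ ≤ |CA| * W := by
        calc |CA| * (𝓛 ^ 6)⁻¹ ≤ |CA| * 1 := by gcongr
          _ ≤ |CA| * W := by gcongr
      exact mul_le_mul_of_nonneg_right this hR0
    have e3 : |Cξ| * 𝓛 * (1 + 𝓛 ^ (1.1 : ℝ)) ^ 4 ≤ |Cξ| * W * R := by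
      calc |Cξ| * 𝓛 * (1 + 𝓛 ^ (1.1 : ℝ)) ^ 4 = |Cξ| * W * 1 := by rw [hWdef]; ring
        _ ≤ |Cξ| * W * R := by gcongr
    calc (‖deriv χ.LFunction 1‖ * cb + |CA| * (𝓛 ^ 6)⁻¹) * R + |Cξ| * 𝓛 * (1 + 𝓛 ^ (1.1 : ℝ)) ^ 4
        = ‖deriv χ.LFunction 1‖ * cb * R + |CA| * (𝓛 ^ 6)⁻¹ * R +
            |Cξ| * 𝓛 * (1 + 𝓛 ^ (1.1 : ℝ)) ^ 4 := by ring
      _ ≤ 4 * Real.exp (9 / 2) * cb * W * R + |CA| * W * R + |Cξ| * W * R :=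
          add_le_add (add_le_add e1 e2) e3
      _ = (4 * Real.exp (9 / 2) * cb + |CA| + |Cξ|) * W * R := by ring
  calc 500 / 𝓛 ^ 9 * (4 * B) ≤ 500 / 𝓛 ^ 9 * (4 * (K₁ * W * R)) := by gcongr
    _ = 2000 * K₁ * (W * (𝓛 ^ 9)⁻¹) * R := by rw [div_eq_mul_inv]; ring
    _ = 2000 * K₁ * (𝓛 * (1 + 𝓛 ^ (1.1 : ℝ)) ^ 4 * (𝓛 ^ 9)⁻¹) * R := by rw [hWdef]

/-- (Twin of `Lemma102.frakv2_windows_le_of_lemma83Rel` UNDER THE MINIMUM PREMISE, UNCONDITIONAL; guard `↦ ‖L(1,χ)‖ ≤ 𝓛⁻¹⁵`.) **The derivable form of (10.11) on the three edge windows** (hypothesis shaped as clause 4 of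
`Skeleton.Lemma102 c′`: `dr ∈ (P^{0.5}/T, P^{0.5}] ∪ (P^{0.502}/T, P^{0.502}] ∪ (P^{0.504}/T, P^{0.504})`):
under `Skeleton.Lemma83Rel c′`, for `D` large, (A), `1 ≤ j ≤ 3`, `d, r ≥ 1`,
`‖𝔳₂ⱼ(d,r)‖ ≤ C·𝓛(1 + 𝓛^{1.1})⁴(𝓛⁹)⁻¹·(∏_{q∣dr}(1−q⁻¹)⁻¹)²` (each window lies below `P^{0.504}`).
The printed `O(𝓛⁻⁷)` is not claimed (row G-d60-1). [cite: Zhang2022LandauSiegel, §10 Lemma 10.2 (10.11)] -/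
theorem frakv2_windows_le_pow15 (c' : ℝ) :
    ∃ C : ℝ, ForAllLarge fun D _ χ => ‖χ.LFunction 1‖ ≤ 1 / Real.log D ^ 15 → ∀ j ∈ ({1, 2, 3} : Finset ℕ), ∀ d r : ℕ,
      1 ≤ d → 1 ≤ r →
        ((bigP D ^ (0.5 : ℝ) / bigT D < ((d * r : ℕ) : ℝ) ∧ ((d * r : ℕ) : ℝ) ≤ bigP D ^ (0.5 : ℝ)) ∨
          (bigP D ^ (0.502 : ℝ) / bigT D < ((d * r : ℕ) : ℝ) ∧
            ((d * r : ℕ) : ℝ) ≤ bigP D ^ (0.502 : ℝ)) ∨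
          (bigP D ^ (0.504 : ℝ) / bigT D < ((d * r : ℕ) : ℝ) ∧
            ((d * r : ℕ) : ℝ) < bigP D ^ (0.504 : ℝ))) →
        ‖frakv2 c' χ j d r‖ ≤
          C * (ell D * (1 + ell D ^ (1.1 : ℝ)) ^ 4 * (ell D ^ 9)⁻¹) *
            (∏ q ∈ (d * r).primeFactors, (1 - (q : ℝ)⁻¹)⁻¹) ^ 2 := by
  obtain ⟨C, D₀, h⟩ := frakv2_low_le_pow15 c'
  obtain ⟨D₅, hD₅⟩ := exists_nat_le_log₄ 5
  refine ⟨C, max D₀ D₅, fun D _ χ hD hq hp hA j hj d r hd hr hwin => ?_⟩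
  have hD₀ : D₀ ≤ D := le_trans (le_max_left _ _) hD
  have hL5 : 5 ≤ ell D := by rw [ell]; exact hD₅ D (le_trans (le_max_right _ _) hD)
  have hP1 : 1 < bigP D := by
    rw [bigP]; exact Real.one_lt_exp_iff.2 (by positivity)
  have hlt : ∀ {a : ℝ}, a < 0.504 → bigP D ^ a < bigP D ^ (0.504 : ℝ) := fun ha =>
    Real.rpow_lt_rpow_of_exponent_lt hP1 ha
  refine h D χ hD₀ hq hp hA j hj d r hd hr ?_
  rcases hwin with ⟨-, h1⟩ | ⟨-, h2⟩ | ⟨-, h3⟩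
  · exact lt_of_le_of_lt h1 (hlt (by norm_num))
  · exact lt_of_le_of_lt h2 (hlt (by norm_num))
  · exact h3


/-- **The window clause (10.11) in the reading of record (`Typed.Sec10Rel.Eq1011RelD c′`) UNDER THE MINIMUM PREMISE,
UNCONDITIONAL** — its body with guard `AssumptionA D χ` replaced by `‖L(1,χ)‖ ≤ 𝓛⁻¹⁵` (twin of
`Lemma102.eq1011RelD_of_lemma83Rel`: `frakv2_windows_le_pow15` with `log T = 𝓛^{1.1}`, `log P = 𝓛⁹`).
[cite: Zhang2022LandauSiegel, §10 Lemma 10.2 (10.11) p.55] -/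
theorem eq1011RelD_pow15 (c' : ℝ) :
    ∃ C : ℝ, ForAllLarge fun D _ χ => ‖χ.LFunction 1‖ ≤ 1 / Real.log D ^ 15 →
      ∀ j ∈ ({1, 2, 3} : Finset ℕ), ∀ d r : ℕ, 1 ≤ d → 1 ≤ r →
        ((d * r : ℕ) : ℝ) ∈ Typed.Sec10A.edgeWindows D →
          ‖frakv2 c' χ j d r‖ ≤
            C * ell D * (1 + Real.log (bigT D)) ^ 4 / Real.log (bigP D) *
              (∏ q ∈ (d * r).primeFactors, (1 - (q : ℝ)⁻¹)⁻¹) ^ 2 := by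
  obtain ⟨C, D₀, h⟩ := frakv2_windows_le_pow15 c'
  refine ⟨C, D₀, fun D _ χ hD hq hp hA j hj d r hd hr hw => ?_⟩
  have hb := h D χ hD hq hp hA j hj d r hd hr ((Typed.Sec10A.mem_edgeWindows_iff D _).mp hw)
  have hT : Real.log (bigT D) = ell D ^ (1.1 : ℝ) := by rw [bigT, Real.log_exp]
  have hP : Real.log (bigP D) = ell D ^ 9 := by rw [bigP, Real.log_exp]
  rw [hT, hP, div_eq_mul_inv]
  calc _ ≤ C * (ell D * (1 + ell D ^ (1.1 : ℝ)) ^ 4 * (ell D ^ 9)⁻¹) *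
        (∏ q ∈ (d * r).primeFactors, (1 - (q : ℝ)⁻¹)⁻¹) ^ 2 := hb
    _ = _ := by ring

/-- **The window clause under `Repair.Bed.AssumptionAWith E`, every real `E ≥ 15`, UNCONDITIONAL** (transfer lemma; at
the printed `E = 2022` the body is that of `Typed.Sec10Rel.Eq1011RelD c′`, not restated).
[cite: Zhang2022LandauSiegel, §10 Lemma 10.2 (10.11) p.55] -/
theorem eq1011RelD_of_assumptionAWith (c' : ℝ) {E : ℝ} (hE : 15 ≤ E) :
    ∃ C : ℝ, ForAllLarge fun D _ χ => AssumptionAWith E D χ →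
      ∀ j ∈ ({1, 2, 3} : Finset ℕ), ∀ d r : ℕ, 1 ≤ d → 1 ≤ r →
        ((d * r : ℕ) : ℝ) ∈ Typed.Sec10A.edgeWindows D →
          ‖frakv2 c' χ j d r‖ ≤
            C * ell D * (1 + Real.log (bigT D)) ^ 4 / Real.log (bigP D) *
              (∏ q ∈ (d * r).primeFactors, (1 - (q : ℝ)⁻¹)⁻¹) ^ 2 := by
  obtain ⟨C, h⟩ := eq1011RelD_pow15 c'
  exact ⟨C, Repair.Gap.forAllLarge_assumptionAWith_of_pow15 hE h⟩

end Literature.NumberTheory.LFunctions.Zhang2022.Lemma102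

end
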